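import Summits.AtomisticToContinuum.FouriersLaw.Theorems.EmbeddedDrudeMourreDrudeDissolutionStubGramContinuityMarkovState
import Literature.MathematicalPhysics.KineticTheory.InfiniteChainMarkovSuperstable
import Literature.MathematicalPhysics.KineticTheory.InfiniteChainGibbsStationarityPinned
import HarnessLib

/-!
# Stub G `stub_gramContinuity`, tool 6: moments of local polynomials are bounded UNIFORMLY along
the coupling ray (line `gram-pencil-harmonic-chaos`, crux `EmbeddedDrudeMourre.DrudeDissolution`,
item stmt-AtomisticToContinuum-12593; `--supports` file, closes nothing)

WHAT. For `ω₂ > 0`, `a, b ≥ 0`, any family `ε ↦ μ_ε` of shift-invariant DLR states at `T = 1` of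
`pinnedChain ω₂ (aε) (bε) 1`, `ε ∈ [0, 1]`, and every local polynomial `u ∈ 𝒫`:
`sup_{ε ∈ [0,1]} ∫ |u|^k dμ_ε < ∞` for every `k` (`pencil_uniform_moments`, registered sub-goal of
stub G) — clause (i) of stub G is `k = 2`, and the uniform `L²` bounds enter the uniform clustering
majorant of clause (ii) and the truncation argument of clause (iii).

PROOF. By `pencil_markov_state` (tool 5) `μ_ε` integrates window observables against the Markov
window densities with `h_ε ≤ B` uniformly; the tree's window bound
`lintegral_exp_bmLocalEnergy_le` then gives `μ_ε(e^{W_{x,0}/2}) ≤ B² ∫ e^{1/2} e^{-(p²/2+U_ε)/2}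
≤ B² ∫ e^{1/2} e^{-(p²/2+ω₂q²/2)/2}` (`U_ε ≥ U_0`), whence uniform site moments
(`|q|, |p| ≤ c W_{x,0}`, `Wⁿ ≤ n! 2ⁿ e^{W/2}`), and the structural induction of
`measurable_and_integrable_pow_of_mem_polyObs` with uniform constants.
-/

noncomputable section

open MeasureTheory Set Filter Function Topology
open scoped InnerProductSpace ENNReal
open Literature.MathematicalPhysics.KineticTheory
open Literature.MathematicalPhysics.KineticTheory.HeatConduction
open Literature.MathematicalPhysics.KineticTheory.HeatConduction.OscillatorChain

namespace Summit.AtomisticToContinuum.FouriersLaw.Theorems.DrudeDissolution.GramPencilHarmonicChaos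

/-- **Uniform site moments along the coupling ray**: for every `n` and every site `x` there is `C`
with `∫ (|q_x|ⁿ + |p_x|ⁿ) dμ_ε ≤ C` for all `ε ∈ [0, 1]` and all shift-invariant DLR states `μ_ε`
at `T = 1` of `pinnedChain ω₂ (aε) (bε) 1`. [folklore] -/
theorem pencil_uniform_site_moments {ω₂ a b : ℝ} (hω : 0 < ω₂) (ha : 0 ≤ a) (hb : 0 ≤ b)
    {μ : ℝ → Measure ChainConfig}
    (hμ : ∀ ε ∈ Set.Icc (0 : ℝ) 1, (pinnedChain ω₂ (a * ε) (b * ε) 1).IsChainGibbsMeasure 1 (μ ε) ∧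
      IsShiftInvariant (μ ε)) (n : ℕ) (x : ℤ) :
    ∃ C : ℝ, ∀ ε ∈ Set.Icc (0 : ℝ) 1,
      Integrable (fun σ : ChainConfig => |(σ x).1| ^ n + |(σ x).2| ^ n) (μ ε) ∧
      ∫ σ, (|(σ x).1| ^ n + |(σ x).2| ^ n) ∂(μ ε) ≤ C := by
  classical
  obtain ⟨lam, h, B, m, lmin, -, hlmin, -, -, hall⟩ := pencil_markov_state' hω ha hb
  -- the uniform Gaussian one-site integral
  set g₀ : ℝ × ℝ → ℝ≥0∞ := fun z => ENNReal.ofReal (Real.exp ((2 : ℝ)⁻¹) *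
    Real.exp (-(2 : ℝ)⁻¹ * (z.2 ^ 2 / 2 + (pinnedChain ω₂ 0 0 1).U z.1))) with hg₀
  have hI₀ : ∫⁻ z, g₀ z ≠ ∞ := by
    have h2 : (0 : ℝ) < 2 := by norm_num
    have hint : Integrable (fun z : ℝ × ℝ => Real.exp ((2 : ℝ)⁻¹) *
        Real.exp (-(2 : ℝ)⁻¹ * (z.2 ^ 2 / 2 + (pinnedChain ω₂ 0 0 1).U z.1))) :=
      ((pinnedChain ω₂ 0 0 1).integrable_siteWeight h2
        (integrable_exp_neg_pinning h2 hω le_rfl 0 1)).const_mul _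
    exact ((hasFiniteIntegral_iff_ofReal (Eventually.of_forall fun z => by positivity)).1
      hint.hasFiniteIntegral).ne
  set E : ℝ≥0∞ := ENNReal.ofReal B ^ 2 * ∫⁻ z, g₀ z with hE
  have hEt : E ≠ ∞ := ENNReal.mul_ne_top (ENNReal.pow_ne_top ENNReal.ofReal_ne_top) hI₀
  -- the constants
  set Kc : ℝ := (1 + 2 / ω₂) ^ n + 3 ^ n with hKc
  have hKc0 : 0 ≤ Kc := by positivity
  refine ⟨Kc * ((n.factorial : ℝ) / (1 / 2) ^ n * E.toReal), fun ε hε => ?_⟩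
  obtain ⟨hG, hS⟩ := hμ ε hε
  haveI : IsProbabilityMeasure (μ ε) := hG.1
  obtain ⟨-, hhm, hhpos, hhle, hstate⟩ := hall ε hε
  obtain ⟨hwin, -⟩ := hstate (μ ε) hG hS
  set P : OscillatorChain := pinnedChain ω₂ (a * ε) (b * ε) 1 with hP
  have haε : 0 ≤ a * ε := mul_nonneg ha hε.1
  have hbε : 0 ≤ b * ε := mul_nonneg hb hε.1
  have hUm : Measurable P.U := measurable_pinnedChain_U _ _ _ _
  have hVm : Measurable P.V := by
    show Measurable fun r : ℝ => r ^ 2 / 2 + b * ε * r ^ 4 / 4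
    fun_prop
  have hU0 : ∀ r, 0 ≤ P.U r := pinnedChain_U_nonneg _ _ hω.le haε
  have hV0 : ∀ r, 0 ≤ P.V r := fun r => by
    show (0 : ℝ) ≤ r ^ 2 / 2 + b * ε * r ^ 4 / 4
    positivity
  have hVe : ∀ r, P.V (-r) = P.V r := fun r => by
    show (-r) ^ 2 / 2 + b * ε * (-r) ^ 4 / 4 = r ^ 2 / 2 + b * ε * r ^ 4 / 4
    ring
  -- the window data
  obtain ⟨k, hk⟩ : ∃ k : ℝ × ℝ → ℝ × ℝ → ℝ≥0∞, ∀ z z', k z z' =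
      ENNReal.ofReal (Real.exp (-(1 : ℝ)⁻¹ * P.V (z'.1 - z.1))) := ⟨_, fun _ _ => rfl⟩
  obtain ⟨φ, hφ⟩ : ∃ φ : ℝ × ℝ → ℝ≥0∞, ∀ z, φ z = ENNReal.ofReal (h ε z) := ⟨_, fun _ => rfl⟩
  obtain ⟨w, hw⟩ : ∃ w : ℝ × ℝ → ℝ≥0∞, ∀ z, w z =
      ENNReal.ofReal (Real.exp (-(1 : ℝ)⁻¹ * (z.2 ^ 2 / 2 + P.U z.1))) := ⟨_, fun _ => rfl⟩
  obtain ⟨L, hL⟩ : ∃ L : ℝ≥0∞, L = ENNReal.ofReal (lam ε) := ⟨_, rfl⟩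
  obtain ⟨D, hD⟩ : ∃ D : ℤ → ℕ → ChainConfig → ℝ≥0∞, ∀ a₀ n σ, D a₀ n σ = φ (σ a₀) * φ (σ (a₀ + n)) *
      (∏ j ∈ Finset.range n, k (σ (a₀ + j)) (σ (a₀ + j + 1)) * L⁻¹) *
      ∏ j ∈ Finset.range (n + 1), w (σ (a₀ + j)) := ⟨_, fun _ _ _ => rfl⟩
  have hwindow := hwin k φ w L D hk hφ hw hL hD
  have hφB : ∀ z, φ z ≤ ENNReal.ofReal B := fun z => by
    rw [hφ]; exact ENNReal.ofReal_le_ofReal (hhle z)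
  -- the exponential moment of `W_{x,0}`, uniformly
  have hhalf0 : (0 : ℝ) < 1 / 2 := by norm_num
  have hhalf : (1 / 2 : ℝ) ≤ (2 * 1)⁻¹ := by norm_num
  have hexp := P.lintegral_exp_bmLocalEnergy_le hUm hVm one_pos hU0 hV0 hVe hw hk hφB hD hwindow
    hhalf0 hhalf x 0
  simp only [mul_zero, pow_zero, mul_one, zero_add, pow_one] at hexp
  have hg_le : ∫⁻ z : ℝ × ℝ, ENNReal.ofReal (Real.exp ((2 : ℝ)⁻¹) *
      Real.exp (-(2 : ℝ)⁻¹ * (z.2 ^ 2 / 2 + P.U z.1))) ≤ ∫⁻ z, g₀ z := by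
    refine lintegral_mono fun z => ENNReal.ofReal_le_ofReal ?_
    refine mul_le_mul_of_nonneg_left (Real.exp_le_exp.2 ?_) (Real.exp_pos _).le
    have h1 : (pinnedChain ω₂ 0 0 1).U z.1 ≤ P.U z.1 := by
      show ω₂ * z.1 ^ 2 / 2 + 0 * z.1 ^ 4 / 4 ≤ ω₂ * z.1 ^ 2 / 2 + a * ε * z.1 ^ 4 / 4
      have : 0 ≤ z.1 ^ 4 := by positivity
      nlinarith
    have h2 : (0 : ℝ) < (2 : ℝ)⁻¹ := by norm_num
    nlinarith
  have hexpE : ∫⁻ σ, ENNReal.ofReal (Real.exp (1 / 2 * P.bmLocalEnergy x 0 σ)) ∂(μ ε) ≤ E :=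
    hexp.trans (by rw [hE]; gcongr)
  -- integrability and the real bound for `e^{W/2}`
  have hWm : Measurable fun σ => Real.exp (1 / 2 * P.bmLocalEnergy x 0 σ) :=
    Real.measurable_exp.comp ((P.measurable_bmLocalEnergy hUm hVm x 0).const_mul _)
  have hnn : 0 ≤ᵐ[μ ε] fun σ => Real.exp (1 / 2 * P.bmLocalEnergy x 0 σ) :=
    Eventually.of_forall fun σ => (Real.exp_pos _).le
  have hintE : Integrable (fun σ => Real.exp (1 / 2 * P.bmLocalEnergy x 0 σ)) (μ ε) := by
    refine ⟨hWm.aestronglyMeasurable, ?_⟩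
    rw [hasFiniteIntegral_iff_ofReal hnn]
    exact lt_of_le_of_lt hexpE hEt.lt_top
  have hleE : ∫ σ, Real.exp (1 / 2 * P.bmLocalEnergy x 0 σ) ∂(μ ε) ≤ E.toReal := by
    rw [integral_eq_lintegral_of_nonneg_ae hnn hWm.aestronglyMeasurable]
    exact ENNReal.toReal_mono hEt hexpE
  -- `|q|ⁿ + |p|ⁿ ≤ Kc Wⁿ ≤ Kc n! 2ⁿ e^{W/2}`
  have hW0 : ∀ σ, 0 ≤ P.bmLocalEnergy x 0 σ := fun σ =>
    zero_le_one.trans (one_le_bmLocalEnergy hU0 hV0 x 0 σ)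
  have hpt : ∀ σ : ChainConfig, |(σ x).1| ^ n + |(σ x).2| ^ n ≤
      Kc * ((n.factorial : ℝ) / (1 / 2) ^ n * Real.exp (1 / 2 * P.bmLocalEnergy x 0 σ)) := by
    intro σ
    obtain ⟨hq, hp⟩ := abs_le_mul_bmLocalEnergy_zero_pinnedChain (b * ε) 1 hω haε x σ
    have hqm := pow_le_pow_left₀ (abs_nonneg _) hq n
    have hpm := pow_le_pow_left₀ (abs_nonneg _) hp n
    rw [mul_pow] at hqm hpm
    have h1 : |(σ x).1| ^ n + |(σ x).2| ^ n ≤ Kc * P.bmLocalEnergy x 0 σ ^ n := by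
      rw [hKc, add_mul]; exact add_le_add hqm hpm
    exact h1.trans (mul_le_mul_of_nonneg_left
      (pow_le_factorial_div_pow_mul_exp hhalf0 (hW0 σ) n) hKc0)
  have hmeas : Measurable fun σ : ChainConfig => |(σ x).1| ^ n + |(σ x).2| ^ n :=
    ((measurable_pi_apply x).fst.abs.pow_const n).add ((measurable_pi_apply x).snd.abs.pow_const n)
  have hdom : Integrable (fun σ => Kc * ((n.factorial : ℝ) / (1 / 2) ^ n *
      Real.exp (1 / 2 * P.bmLocalEnergy x 0 σ))) (μ ε) := (hintE.const_mul _).const_mul _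
  have hint : Integrable (fun σ : ChainConfig => |(σ x).1| ^ n + |(σ x).2| ^ n) (μ ε) := by
    refine hdom.mono' hmeas.aestronglyMeasurable (Eventually.of_forall fun σ => ?_)
    rw [Real.norm_of_nonneg (by positivity)]
    exact hpt σ
  refine ⟨hint, ?_⟩
  calc ∫ σ, (|(σ x).1| ^ n + |(σ x).2| ^ n) ∂(μ ε)
      ≤ ∫ σ, Kc * ((n.factorial : ℝ) / (1 / 2) ^ n * Real.exp (1 / 2 * P.bmLocalEnergy x 0 σ)) ∂(μ ε) :=
        integral_mono hint hdom hpt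
    _ = Kc * ((n.factorial : ℝ) / (1 / 2) ^ n * ∫ σ, Real.exp (1 / 2 * P.bmLocalEnergy x 0 σ) ∂(μ ε)) := by
        rw [integral_const_mul, integral_const_mul]
    _ ≤ Kc * ((n.factorial : ℝ) / (1 / 2) ^ n * E.toReal) := by
        gcongr

/-- **Moments of local polynomials are bounded uniformly along the coupling ray** (named-hypotheses
form of the registered `pencil_uniform_moments`). [folklore] -/
theorem pencil_uniform_moments' {ω₂ a b : ℝ} (hω : 0 < ω₂) (ha : 0 ≤ a) (hb : 0 ≤ b)
    {μ : ℝ → Measure ChainConfig}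
    (hμ : ∀ ε ∈ Set.Icc (0 : ℝ) 1, (pinnedChain ω₂ (a * ε) (b * ε) 1).IsChainGibbsMeasure 1 (μ ε) ∧
      IsShiftInvariant (μ ε))
    {f : ChainConfig → ℝ} (hf : f ∈ Algebra.adjoin ℝ (Set.range fun xc : ℤ × Bool =>
      fun σ : ChainConfig => if xc.2 then (σ xc.1).2 else (σ xc.1).1)) :
    Measurable f ∧ ∀ k : ℕ, ∃ M : ℝ, ∀ ε ∈ Set.Icc (0 : ℝ) 1,
      Integrable (fun σ => |f σ| ^ k) (μ ε) ∧ ∫ σ, |f σ| ^ k ∂(μ ε) ≤ M := by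
  have hprob : ∀ ε ∈ Set.Icc (0 : ℝ) 1, IsProbabilityMeasure (μ ε) := fun ε hε => (hμ ε hε).1.1
  induction hf using Algebra.adjoin_induction with
  | mem f hf =>
    obtain ⟨⟨x, bb⟩, rfl⟩ := hf
    cases bb
    · simp only [Bool.false_eq_true, if_false]
      refine ⟨(measurable_pi_apply x).fst, fun k => ?_⟩
      obtain ⟨C, hC⟩ := pencil_uniform_site_moments hω ha hb hμ k x
      refine ⟨C, fun ε hε => ?_⟩
      obtain ⟨hint, hle⟩ := hC ε hε
      refine ⟨(integrable_abs_pow_of_add hint).1, le_trans ?_ hle⟩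
      exact integral_mono (integrable_abs_pow_of_add hint).1 hint fun σ =>
        le_add_of_nonneg_right (by positivity)
    · simp only [if_true]
      refine ⟨(measurable_pi_apply x).snd, fun k => ?_⟩
      obtain ⟨C, hC⟩ := pencil_uniform_site_moments hω ha hb hμ k x
      refine ⟨C, fun ε hε => ?_⟩
      obtain ⟨hint, hle⟩ := hC ε hε
      refine ⟨(integrable_abs_pow_of_add hint).2, le_trans ?_ hle⟩
      exact integral_mono (integrable_abs_pow_of_add hint).2 hint fun σ =>
        le_add_of_nonneg_left (by positivity)
  | algebraMap r =>
    have hr : (algebraMap ℝ (ChainConfig → ℝ) r) = fun _ => r := rfl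
    rw [hr]
    refine ⟨measurable_const, fun k => ⟨|r| ^ k, fun ε hε => ?_⟩⟩
    haveI := hprob ε hε
    refine ⟨integrable_const _, ?_⟩
    rw [integral_const, smul_eq_mul, probReal_univ, one_mul]
  | add f₁ f₂ _ _ ih₁ ih₂ =>
    refine ⟨ih₁.1.add ih₂.1, fun k => ?_⟩
    obtain ⟨M₁, hM₁⟩ := ih₁.2 k
    obtain ⟨M₂, hM₂⟩ := ih₂.2 k
    refine ⟨2 ^ (k - 1) * (M₁ + M₂), fun ε hε => ?_⟩
    obtain ⟨hi₁, hl₁⟩ := hM₁ ε hε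
    obtain ⟨hi₂, hl₂⟩ := hM₂ ε hε
    have hdom : Integrable (fun σ => 2 ^ (k - 1) * (|f₁ σ| ^ k + |f₂ σ| ^ k)) (μ ε) :=
      (hi₁.add hi₂).const_mul _
    have hpt : ∀ σ, |(f₁ + f₂) σ| ^ k ≤ 2 ^ (k - 1) * (|f₁ σ| ^ k + |f₂ σ| ^ k) := fun σ => by
      rw [Pi.add_apply]
      exact (pow_le_pow_left₀ (abs_nonneg _) (abs_add_le _ _) k).trans
        (add_pow_le (abs_nonneg _) (abs_nonneg _) k)
    have hint : Integrable (fun σ => |(f₁ + f₂) σ| ^ k) (μ ε) := by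
      refine hdom.mono' ((ih₁.1.add ih₂.1).abs.pow_const k).aestronglyMeasurable
        (Eventually.of_forall fun σ => ?_)
      rw [Real.norm_of_nonneg (by positivity)]
      exact hpt σ
    refine ⟨hint, ?_⟩
    calc ∫ σ, |(f₁ + f₂) σ| ^ k ∂(μ ε) ≤ ∫ σ, 2 ^ (k - 1) * (|f₁ σ| ^ k + |f₂ σ| ^ k) ∂(μ ε) :=
          integral_mono hint hdom hpt
      _ = 2 ^ (k - 1) * (∫ σ, |f₁ σ| ^ k ∂(μ ε) + ∫ σ, |f₂ σ| ^ k ∂(μ ε)) := by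
          rw [integral_const_mul, integral_add hi₁ hi₂]
      _ ≤ 2 ^ (k - 1) * (M₁ + M₂) := by gcongr
  | mul f₁ f₂ _ _ ih₁ ih₂ =>
    refine ⟨ih₁.1.mul ih₂.1, fun k => ?_⟩
    obtain ⟨M₁, hM₁⟩ := ih₁.2 (2 * k)
    obtain ⟨M₂, hM₂⟩ := ih₂.2 (2 * k)
    refine ⟨M₁ + M₂, fun ε hε => ?_⟩
    obtain ⟨hi₁, hl₁⟩ := hM₁ ε hε
    obtain ⟨hi₂, hl₂⟩ := hM₂ ε hε
    have hdom : Integrable (fun σ => |f₁ σ| ^ (2 * k) + |f₂ σ| ^ (2 * k)) (μ ε) := hi₁.add hi₂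
    have hpt : ∀ σ, |(f₁ * f₂) σ| ^ k ≤ |f₁ σ| ^ (2 * k) + |f₂ σ| ^ (2 * k) := fun σ => by
      rw [Pi.mul_apply, abs_mul, mul_pow, pow_mul' |f₁ σ| 2 k, pow_mul' |f₂ σ| 2 k]
      nlinarith [two_mul_le_add_sq (|f₁ σ| ^ k) (|f₂ σ| ^ k),
        mul_nonneg (pow_nonneg (abs_nonneg (f₁ σ)) k) (pow_nonneg (abs_nonneg (f₂ σ)) k)]
    have hint : Integrable (fun σ => |(f₁ * f₂) σ| ^ k) (μ ε) := by
      refine hdom.mono' ((ih₁.1.mul ih₂.1).abs.pow_const k).aestronglyMeasurable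
        (Eventually.of_forall fun σ => ?_)
      rw [Real.norm_of_nonneg (by positivity)]
      exact hpt σ
    refine ⟨hint, ?_⟩
    calc ∫ σ, |(f₁ * f₂) σ| ^ k ∂(μ ε) ≤ ∫ σ, (|f₁ σ| ^ (2 * k) + |f₂ σ| ^ (2 * k)) ∂(μ ε) :=
          integral_mono hint hdom hpt
      _ = (∫ σ, |f₁ σ| ^ (2 * k) ∂(μ ε)) + ∫ σ, |f₂ σ| ^ (2 * k) ∂(μ ε) := integral_add hi₁ hi₂
      _ ≤ M₁ + M₂ := add_le_add hl₁ hl₂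

/-- **Moments of local polynomials are bounded uniformly along the coupling ray** (registered
sub-goal of stub G; see `pencil_uniform_moments'`). [folklore] -/
theorem pencil_uniform_moments : ∀ ω₂ a b : ℝ, 0 < ω₂ → 0 ≤ a → 0 ≤ b →
    ∀ μ : ℝ → MeasureTheory.Measure Literature.MathematicalPhysics.KineticTheory.HeatConduction.ChainConfig,
      (∀ ε ∈ Set.Icc (0 : ℝ) 1,
        (Literature.MathematicalPhysics.KineticTheory.HeatConduction.pinnedChain
          ω₂ (a * ε) (b * ε) 1).IsChainGibbsMeasure 1 (μ ε) ∧
        Literature.MathematicalPhysics.KineticTheory.HeatConduction.IsShiftInvariant (μ ε)) →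
      ∀ f ∈ Algebra.adjoin ℝ (Set.range fun xc : ℤ × Bool =>
        fun σ : Literature.MathematicalPhysics.KineticTheory.HeatConduction.ChainConfig =>
          if xc.2 then (σ xc.1).2 else (σ xc.1).1),
      Measurable f ∧ ∀ k : ℕ, ∃ M : ℝ, ∀ ε ∈ Set.Icc (0 : ℝ) 1,
        MeasureTheory.Integrable (fun σ => |f σ| ^ k) (μ ε) ∧ ∫ σ, |f σ| ^ k ∂(μ ε) ≤ M :=
  fun _ _ _ hω ha hb _ hμ _ hf => pencil_uniform_moments' hω ha hb hμ hf

end Summit.AtomisticToContinuum.FouriersLaw.Theorems.DrudeDissolution.GramPencilHarmonicChaos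

end
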